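import Literature.Topology.FourManifolds.PiecePar
import HarnessLib

/-!
# Conjugating self-isotopies through a chart

Topic `Literature/Topology/FourManifolds` (programme of the fact
`Literature.Topology.FourManifolds.cerf_pi0DiffDisc_relBoundary_three`, brick C3 (E′)).  A recurring manœuvre in the realisation of face germs
of Cerf's model pieces: a model `M` (e.g. the half-ball) is identified near part of its boundary
with a simpler model `N` (a convex product region, or the round ball) by a chart `Ξ : O ≅ O'`
(smooth with smooth inverse `Λ` between open sets, `Ξ (M ∩ O) = N ∩ O'`); a self-isotopy `D`
of `N` whose stages are the identity off a compact `S ⊆ O'` then CONJUGATES to a self-isotopy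
`K_t = Λ ∘ D_t ∘ Ξ` (on `O`; the identity elsewhere) of `M` (`IsSelfIsotopy.exists_conj`).

## References
* [CerfDiffeoSphere1968] J. Cerf, LNM 53 (1968), Ch. IV §3 (models and their rounded forms).
* [HirschDT1976] M. W. Hirsch, *Differential Topology*, GTM 33 (1976), Ch. 8 §1.
-/

noncomputable section

open Set Function Filter Topology Metric
open scoped ContDiff

namespace Literature.Topology.FourManifolds

namespace IsSelfIsotopy

variable {E : Type*} [NormedAddCommGroup E] [InnerProductSpace ℝ E]

/-- **A chart between open sets**: `Ξ : O → O'` smooth with smooth inverse `Λ : O' → O`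
(both given as global functions). [folklore] -/
structure IsChartPair (O O' : Set E) (Ξ Λ : E → E) : Prop where
  isOpen_source : IsOpen O
  isOpen_target : IsOpen O'
  contDiffOn : ContDiffOn ℝ ∞ Ξ O
  contDiffOn_symm : ContDiffOn ℝ ∞ Λ O'
  mapsTo : MapsTo Ξ O O'
  mapsTo_symm : MapsTo Λ O' O
  left_inv : ∀ x ∈ O, Λ (Ξ x) = x
  right_inv : ∀ y ∈ O', Ξ (Λ y) = y

namespace IsChartPair

variable {O O' : Set E} {Ξ Λ : E → E}

/-- `symm` (symm). [folklore] -/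
theorem symm (h : IsChartPair O O' Ξ Λ) : IsChartPair O' O Λ Ξ :=
  ⟨h.isOpen_target, h.isOpen_source, h.contDiffOn_symm, h.contDiffOn, h.mapsTo_symm, h.mapsTo,
    h.right_inv, h.left_inv⟩

/-- `contDiffAt` (contDiffAt). [folklore] -/
theorem contDiffAt (h : IsChartPair O O' Ξ Λ) {x : E} (hx : x ∈ O) : ContDiffAt ℝ ∞ Ξ x :=
  h.contDiffOn.contDiffAt (h.isOpen_source.mem_nhds hx)

/-- `image_eq` (image eq). [folklore] -/
theorem image_eq (h : IsChartPair O O' Ξ Λ) : Ξ '' O = O' :=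
  Subset.antisymm (mapsTo_iff_image_subset.1 h.mapsTo) fun y hy =>
    ⟨Λ y, h.mapsTo_symm hy, h.right_inv y hy⟩

/-- The derivative of a chart is invertible at points of its source. [folklore] -/
theorem isInvertible_fderiv (h : IsChartPair O O' Ξ Λ) {x : E} (hx : x ∈ O) :
    (fderiv ℝ Ξ x).IsInvertible := by
  have hΞ : DifferentiableAt ℝ Ξ x := (h.contDiffAt hx).differentiableAt (by simp)
  have hΛ : DifferentiableAt ℝ Λ (Ξ x) := (h.symm.contDiffAt (h.mapsTo hx)).differentiableAt (by simp)
  have h1 : (fderiv ℝ Λ (Ξ x)).comp (fderiv ℝ Ξ x) = ContinuousLinearMap.id ℝ E := by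
    rw [← fderiv_comp x hΛ hΞ]
    have hev : (Λ ∘ Ξ) =ᶠ[𝓝 x] id := by
      filter_upwards [h.isOpen_source.mem_nhds hx] with y hy
      exact h.left_inv y hy
    rw [hev.fderiv_eq, fderiv_id]
  have h2 : (fderiv ℝ Ξ x).comp (fderiv ℝ Λ (Ξ x)) = ContinuousLinearMap.id ℝ E := by
    have hx' : Λ (Ξ x) = x := h.left_inv x hx
    have hΞ' : DifferentiableAt ℝ Ξ (Λ (Ξ x)) := by rw [hx']; exact hΞ
    have hc := fderiv_comp (Ξ x) hΞ' hΛ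
    rw [hx'] at hc
    rw [← hc]
    have hev : (Ξ ∘ Λ) =ᶠ[𝓝 (Ξ x)] id := by
      filter_upwards [h.isOpen_target.mem_nhds (h.mapsTo hx)] with y hy
      exact h.right_inv y hy
    rw [hev.fderiv_eq, fderiv_id]
  refine ⟨ContinuousLinearEquiv.equivOfInverse (fderiv ℝ Ξ x) (fderiv ℝ Λ (Ξ x)) (fun v => ?_)
    (fun w => ?_), rfl⟩
  · simpa using congrArg (fun L : E →L[ℝ] E => L v) h1
  · simpa using congrArg (fun L : E →L[ℝ] E => L w) h2

end IsChartPair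

variable {O O' : Set E} {Ξ Λ : E → E} {M N S : Set E} {D : ℝ → E → E}

/-- **Conjugation of a self-isotopy through a chart.**  Let `Ξ : O ≅ O'` be a chart with
`Ξ (M ∩ O) = N ∩ O'`, `M ∖ O` closed... precisely: `M` compact, and let `D` be a self-isotopy of
`N` whose stages are the identity off a compact `S ⊆ O'` and map `S` into `O'`.  Then
`K_t := Λ ∘ D_t ∘ Ξ` on `O` (the identity elsewhere) is a self-isotopy of `M`.
[folklore] -/
theorem exists_conj (hc : IsChartPair O O' Ξ Λ) (hMN : Ξ '' (M ∩ O) = N ∩ O')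
    (hD : IsSelfIsotopy N D) (hS : IsCompact S) (hSO : S ⊆ O')
    (hfix : ∀ t, ∀ y ∉ S, D t y = y) (hDS : ∀ t, MapsTo (D t) S O') :
    ∃ K : ℝ → E → E, IsSelfIsotopy M K ∧ (∀ t, ∀ x ∈ O, K t x = Λ (D t (Ξ x))) ∧
      ∀ t x, Ξ x ∉ S → K t x = x := by
  classical
  -- the compact set of source points moved by the conjugated family
  set T : Set E := Λ '' S with hT
  have hTc : IsCompact T := hS.image_of_continuousOn (hc.contDiffOn_symm.continuousOn.mono hSO)
  have hTO : T ⊆ O := by rintro _ ⟨y, hy, rfl⟩; exact hc.mapsTo_symm (hSO hy)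
  have hΞT : ∀ x ∈ O, Ξ x ∈ S → x ∈ T := fun x hx hxS => ⟨Ξ x, hxS, hc.left_inv x hx⟩
  set K : ℝ → E → E := fun t x => if x ∈ O then Λ (D t (Ξ x)) else x with hK
  have hKO : ∀ t, ∀ x ∈ O, K t x = Λ (D t (Ξ x)) := fun t x hx => by simp only [hK, if_pos hx]
  have hKfix : ∀ t x, Ξ x ∉ S → K t x = x := fun t x hx => by
    by_cases hxO : x ∈ O
    · rw [hKO t x hxO, hfix t _ hx, hc.left_inv x hxO]
    · simp only [hK, if_neg hxO]
  have hKT : ∀ t, ∀ x ∉ T, K t x = x := fun t x hx => by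
    by_cases hxO : x ∈ O
    · exact hKfix t x fun h => hx (hΞT x hxO h)
    · simp only [hK, if_neg hxO]
  -- values of `D_t ∘ Ξ` stay in `O'` on `O`
  have hDO' : ∀ t, ∀ x ∈ O, D t (Ξ x) ∈ O' := fun t x hx => by
    by_cases h : Ξ x ∈ S
    · exact hDS t h
    · rw [hfix t _ h]; exact hc.mapsTo hx
  -- joint smoothness
  have hsmooth : ContDiff ℝ ∞ (uncurry K) := by
    refine contDiff_iff_contDiffAt.2 fun q => ?_
    obtain ⟨t, x⟩ := q
    by_cases hxO : x ∈ O
    · have hev : uncurry K =ᶠ[𝓝 (t, x)] fun q : ℝ × E => Λ (D q.1 (Ξ q.2)) := by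
        have ho : IsOpen {q : ℝ × E | q.2 ∈ O} := hc.isOpen_source.preimage continuous_snd
        filter_upwards [ho.mem_nhds hxO] with q hq
        exact hKO q.1 q.2 hq
      refine ContDiffAt.congr_of_eventuallyEq ?_ hev
      have h1 : ContDiffAt ℝ ∞ (fun q : ℝ × E => Ξ q.2) (t, x) :=
        (hc.contDiffAt hxO).comp (t, x) contDiffAt_snd
      have h2 : ContDiffAt ℝ ∞ (fun q : ℝ × E => D q.1 (Ξ q.2)) (t, x) :=
        hD.contDiff.contDiffAt.comp (t, x) (contDiffAt_fst.prodMk h1)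
      exact (hc.symm.contDiffAt (hDO' t x hxO)).comp (t, x) h2
    · have hxT : x ∉ T := fun h => hxO (hTO h)
      have hev : uncurry K =ᶠ[𝓝 (t, x)] fun q : ℝ × E => q.2 := by
        have ho : IsOpen {q : ℝ × E | q.2 ∉ T} := hTc.isClosed.isOpen_compl.preimage continuous_snd
        filter_upwards [ho.mem_nhds hxT] with q hq
        exact hKT q.1 q.2 hq
      exact contDiffAt_snd.congr_of_eventuallyEq hev
  have hstage : ∀ t, ContDiff ℝ ∞ (K t) := fun t =>
    hsmooth.comp (contDiff_const.prodMk contDiff_id)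
  -- membership bookkeeping
  have hMO : ∀ x ∈ M, x ∈ O → Ξ x ∈ N ∩ O' := fun x hx hxO => by
    rw [← hMN]; exact mem_image_of_mem Ξ ⟨hx, hxO⟩
  refine ⟨K, ⟨hsmooth, fun t ht => ⟨hstage t, fun x hx => ?_, ?_⟩, fun t ht => ?_, fun x hx => ?_⟩,
    hKO, hKfix⟩
  · -- invertible derivative at points of `M`
    by_cases hxO : x ∈ O
    · have hev : K t =ᶠ[𝓝 x] fun y => Λ (D t (Ξ y)) := by
        filter_upwards [hc.isOpen_source.mem_nhds hxO] with y hy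
        exact hKO t y hy
      rw [hev.fderiv_eq]
      have hΞx := hMO x hx hxO
      have hd1 : DifferentiableAt ℝ Ξ x := (hc.contDiffAt hxO).differentiableAt (by simp)
      have hd2 : DifferentiableAt ℝ (D t) (Ξ x) := (hD.contDiff_stage t).differentiable (by simp) _
      have hd3 : DifferentiableAt ℝ Λ (D t (Ξ x)) :=
        (hc.symm.contDiffAt (hDO' t x hxO)).differentiableAt (by simp)
      rw [show (fun y => Λ (D t (Ξ y))) = Λ ∘ (D t ∘ Ξ) from rfl,
        fderiv_comp x hd3 (hd2.comp x hd1), fderiv_comp x hd2 hd1]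
      obtain ⟨e1, he1⟩ := hc.isInvertible_fderiv hxO
      obtain ⟨e2, he2⟩ := (hD.isEmbGerm t ht).isInvertible (Ξ x) hΞx.1
      obtain ⟨e3, he3⟩ := hc.symm.isInvertible_fderiv (hDO' t x hxO)
      refine ⟨(e1.trans e2).trans e3, ?_⟩
      ext v
      simp [← he1, ← he2, ← he3]
    · have hxT : x ∉ T := fun h => hxO (hTO h)
      have hev : K t =ᶠ[𝓝 x] id := by
        filter_upwards [hTc.isClosed.isOpen_compl.mem_nhds hxT] with y hy
        exact hKT t y hy
      rw [hev.fderiv_eq, fderiv_id]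
      exact ⟨ContinuousLinearEquiv.refl ℝ E, rfl⟩
  · -- injective on `M`
    intro x hx y hy hxy
    by_cases hxO : x ∈ O <;> by_cases hyO : y ∈ O
    · rw [hKO t x hxO, hKO t y hyO] at hxy
      have h1 : D t (Ξ x) = D t (Ξ y) := by
        have := congrArg Ξ hxy
        rwa [hc.right_inv _ (hDO' t x hxO), hc.right_inv _ (hDO' t y hyO)] at this
      have h2 : Ξ x = Ξ y := (hD.isEmbGerm t ht).injOn (hMO x hx hxO).1 (hMO y hy hyO).1 h1
      have := congrArg Λ h2
      rwa [hc.left_inv x hxO, hc.left_inv y hyO] at this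
    · exfalso
      have hyT : y ∉ T := fun h => hyO (hTO h)
      rw [hKT t y hyT, hKO t x hxO] at hxy
      exact hyO (hxy ▸ hc.mapsTo_symm (hDO' t x hxO))
    · exfalso
      have hxT : x ∉ T := fun h => hxO (hTO h)
      rw [hKT t x hxT, hKO t y hyO] at hxy
      exact hxO (hxy.symm ▸ hc.mapsTo_symm (hDO' t y hyO))
    · have hxT : x ∉ T := fun h => hxO (hTO h)
      have hyT : y ∉ T := fun h => hyO (hTO h)
      rwa [hKT t x hxT, hKT t y hyT] at hxy
  · -- image of `M`
    have hDimg : D t '' (N ∩ O') = N ∩ O' := by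
      apply Subset.antisymm
      · rintro _ ⟨y, hy, rfl⟩
        refine ⟨hD.mapsTo ht hy.1, ?_⟩
        by_cases h : y ∈ S
        · exact hDS t h
        · rw [hfix t y h]; exact hy.2
      · intro y hy
        obtain ⟨y', hy', rfl⟩ : y ∈ D t '' N := by rw [hD.image_eq t ht]; exact hy.1
        refine ⟨y', ⟨hy', ?_⟩, rfl⟩
        by_cases h : y' ∈ S
        · exact hSO h
        · have : D t y' = y' := hfix t y' h
          rw [this] at hy; exact hy.2
    apply Subset.antisymm
    · rintro _ ⟨x, hx, rfl⟩
      by_cases hxO : x ∈ O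
      · rw [hKO t x hxO]
        have h1 : D t (Ξ x) ∈ N ∩ O' := by
          rw [← hDimg]; exact mem_image_of_mem _ (hMO x hx hxO)
        obtain ⟨x', hx', hx'eq⟩ : D t (Ξ x) ∈ Ξ '' (M ∩ O) := by rw [hMN]; exact h1
        rw [← hx'eq, hc.left_inv x' hx'.2]
        exact hx'.1
      · rw [hKT t x fun h => hxO (hTO h)]; exact hx
    · intro y hy
      by_cases hyO : y ∈ O
      · have h1 : Ξ y ∈ N ∩ O' := hMO y hy hyO
        obtain ⟨w, hw, hweq⟩ : Ξ y ∈ D t '' (N ∩ O') := by rw [hDimg]; exact h1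
        obtain ⟨x, hx, rfl⟩ : w ∈ Ξ '' (M ∩ O) := by rw [hMN]; exact hw
        refine ⟨x, hx.1, ?_⟩
        rw [hKO t x hx.2, hweq, hc.left_inv y hyO]
      · exact ⟨y, hy, hKT t y fun h => hyO (hTO h)⟩
  · -- time zero on `M`
    by_cases hxO : x ∈ O
    · rw [hKO 0 x hxO, hD.zero_apply _ (hMO x hx hxO).1, hc.left_inv x hxO]
    · exact hKT 0 x fun h => hxO (hTO h)

end IsSelfIsotopy

end Literature.Topology.FourManifolds
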